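import Literature.NumberTheory.CubicFields.CubicResolventClosure
import Literature.NumberTheory.LFunctions.CubicRayClassCharacterCount
import Literature.NumberTheory.GaloisRepresentations.GlobalArtinMapOfCharactersProofs
import Literature.NumberTheory.GaloisRepresentations.ArtinCharacterReciprocityProofs
import Literature.NumberTheory.NumberFields.ClassFieldsOfCharactersUniqueness
import Literature.NumberTheory.NumberFields.ClassFieldsOfIndexThree
import Literature.NumberTheory.QuadraticFields.ConjugateIdealClass
import HarnessLib

/-!
# The cubic Hecke character of the `S₃`-closure of a cubic field (Hasse's dictionary, injective half)

`Proofs` file (theorems only), topic `Literature/NumberTheory/CubicFields`, continuing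
`CubicResolventClosure.lean`. For an abelian cubic extension `L ⊆ k̄` of a number field `k`, unramified
outside a finite set `T` of primes containing the primes above `3`, and a character `χ` of `Gal(L/k)`, the
tree's PROVED Artin reciprocity (`artinReciprocity_character_holds`, `charHecke`) gives the Hecke character
`ω = χ ∘ ψ_{L|k}` with `ω(ϖ_v) = χ(Frob_v)` off `T` (`charHecke_valueAtUniformizer`). Its prime-value
function `ψ(𝔭) = ω(ϖ_𝔭)` (`𝔭 ∉ T`), `ψ(𝔭) = 0` (`𝔭 ∈ T`) is a cubic Dirichlet character modulo a
modulus supported on `T` (Neukirch VII (6.9)/(6.14): `exists_moduleOfDefinition_of_isFiniteOrder`,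
`IsModulus.of_isUnramifiedAt`, `isRayClassCharacter_of_isModulus`), i.e. an element of the set counted in
`LFunctions/CubicRayClassCharacterCount.lean`; and `ψ` determines `L` (`χ` injective: `ψ(𝔭) = 1 ↔ 𝔭`
splits completely, and Bauer's theorem `eq_of_splitPrimes_eventuallyEq`). When `k` is quadratic and `L` is
the `S₃`-closure of a non-Galois cubic field (`CubicResolventClosure`: `Gal(k/ℚ)` inverts `Gal(L/k)`),
`ψ` moreover kills the rational integers prime to `T` ("the character is a ring class character":
`ψ(τ𝔭) = ψ(𝔭)⁻¹`, so `ψ((ℓ)) = ψ(𝔭)ψ(τ𝔭) = 1` for a split `ℓ = 𝔭 · τ𝔭` and `ψ((ℓ)) = ψ(𝔭) = ψ(𝔭)⁻¹ = 1`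
for an inert `ℓ = 𝔭`). This is the injective half of Hasse's correspondence between cubic fields of
discriminant `d_k f²` and cubic ring class characters of `k` modulo `f` (Hasse 1930; Davenport–Heilbronn
1971, §6; Belabas–Bhargava–Pomerance 2010, Lemma 3.3).

## References

* H. Hasse, *Arithmetische Theorie der kubischen Zahlkörper auf klassenkörpertheoretischer Grundlage*,
  Math. Z. 31 (1930) 565–582 [Hasse1930].
* H. Davenport, H. Heilbronn, *On the density of discriminants of cubic fields. II*, Proc. Roy. Soc.
  London A 322 (1971) 405–420, §6 [DavenportHeilbronn1971].
* J. Neukirch, *Algebraic Number Theory*, Ch. VII §6 (6.9), (6.14); §13 (13.10) [NeukirchANT1999].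
-/

noncomputable section

open NumberField Module IntermediateField IsDedekindDomain
open scoped Pointwise

namespace Literature.NumberTheory.CubicFields

open Literature.NumberTheory.NumberFields Literature.NumberTheory.QuadraticFields
  Literature.NumberTheory.GaloisRepresentations Literature.NumberTheory.LFunctions
  Literature.NumberTheory.Automorphic Literature.NumberTheory.EllipticCurves

/-! ### Ray class characters: values off the support -/

section RayClass

variable {K : Type*} [Field K] [NumberField K]

/-- `idealPow` only depends on the values at the primes dividing the ideal. [folklore] -/
theorem idealPow_congr_of_forall_le {ψ ψ' : HeightOneSpectrum (𝓞 K) → ℂ} {I : Ideal (𝓞 K)} (hI : I ≠ ⊥)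
    (h : ∀ v : HeightOneSpectrum (𝓞 K), I ≤ v.asIdeal → ψ v = ψ' v) : idealPow K ψ I = idealPow K ψ' I := by
  unfold idealPow
  refine finprod_congr fun v => ?_
  by_cases hv : I ≤ v.asIdeal
  · rw [h v hv]
  · rw [count_eq_zero_of_not_le hI hv, pow_zero, pow_zero]

/-- **Changing a Dirichlet character `mod 𝔪` at the primes dividing `𝔪` keeps it a Dirichlet character
`mod 𝔪`** (Neukirch VII (6.8): the character lives on `J^𝔪`, the ideals prime to `𝔪`). [folklore] -/
theorem isRayClassCharacter_piecewise {𝔪 : Ideal (𝓞 K)} (h𝔪 : 𝔪 ≠ ⊥) {ψ : HeightOneSpectrum (𝓞 K) → ℂ}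
    (hψ : IsRayClassCharacter 𝔪 ψ) (T : Finset (HeightOneSpectrum (𝓞 K)))
    [DecidablePred fun v : HeightOneSpectrum (𝓞 K) => v ∈ T]
    (hT : ∀ v : HeightOneSpectrum (𝓞 K), v ∈ T → 𝔪 ≤ v.asIdeal) :
    IsRayClassCharacter 𝔪 (fun v => if v ∈ T then 0 else ψ v) := by
  have key : ∀ {b : 𝓞 K}, b ≠ 0 → IsCoprime (Ideal.span {b}) 𝔪 →
      idealPow K (fun v => if v ∈ T then 0 else ψ v) (Ideal.span {b}) = idealPow K ψ (Ideal.span {b}) := by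
    intro b hb hcop
    refine idealPow_congr_of_forall_le (by rw [Ne, Ideal.span_singleton_eq_bot]; exact hb) fun v hv => ?_
    rw [if_neg]
    intro hvT
    exact (isCoprime_iff_forall_not_le h𝔪).mp hcop v (hT v hvT) hv
  refine ⟨fun v hv => ?_, fun b c hb hc hcop hbc hpos => ?_⟩
  · rw [if_neg fun hvT => hv (hT v hvT)]
    exact hψ.norm_eq_one v hv
  · rw [key hc hcop, key hb (isCoprime_span_of_sub_mem hcop hbc)]
    exact hψ.idealPow_span_eq b c hb hc hcop hbc hpos

end RayClass

/-! ### The cubic Hecke character of an abelian cubic extension -/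

section Generic

variable {K : Type} [Field K] [NumberField K]
  (L : IntermediateField K (AlgebraicClosure K)) [FiniteDimensional K L] [IsAbelianGalois K L]

omit [NumberField K] in
/-- An abelian Galois group of order `3` has an injective complex character. [folklore] -/
theorem exists_injective_character (h3 : Nat.card (L ≃ₐ[K] L) = 3) :
    ∃ χ : (L ≃ₐ[K] L) →* ℂˣ, Function.Injective χ := by
  letI : CommGroup (L ≃ₐ[K] L) :=
    { (inferInstance : Group (L ≃ₐ[K] L)) with mul_comm := fun a b => IsMulCommutative.is_comm.comm a b }
  have hbot : (⊥ : Subgroup (L ≃ₐ[K] L)).index = 3 := by rw [Subgroup.index_bot, h3]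
  obtain ⟨χ, hχ⟩ := exists_monoidHom_ker_eq_of_index_eq_three hbot
  exact ⟨χ, (MonoidHom.ker_eq_bot_iff χ).mp hχ⟩

variable [NumberField L]

open scoped Classical in
/-- **The prime-value function of `ω_χ` is a cubic Dirichlet character supported off `T`.**  Let
`L ⊆ K̄` be abelian over `K` with `#Gal(L/K) = 3`, unramified at every prime outside the finite set `T`,
and `χ` a character of `Gal(L/K)`; let `ω = ω_χ` be its Hecke character (`charHecke`, through the tree's
proved Artin reciprocity `artinReciprocity_character_holds`) and `ψ(𝔭) = ω(ϖ_𝔭)` for `𝔭 ∉ T`,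
`ψ(𝔭) = 0` for `𝔭 ∈ T`.  Then `ψ` is a Dirichlet character modulo a nonzero modulus supported on `T`
(Neukirch VII (6.9), (6.14): a module of definition exists and may be moved onto `T`, where `ω` is
unramified), `ψ(𝔭)³ = 1` off `T` (`ψ(𝔭) = χ(Frob_𝔭)`, `Frob_𝔭³ = 1`) and `ψ = 0` on `T`.
[cite: NeukirchANT1999, Ch. VII §6 Prop. (6.9) and Cor. (6.14)] -/
theorem cubicRayClassFunction_spec (χ : (L ≃ₐ[K] L) →* ℂˣ) (h3 : Nat.card (L ≃ₐ[K] L) = 3)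
    (T : Finset (HeightOneSpectrum (𝓞 K)))
    (hunr : ∀ v : HeightOneSpectrum (𝓞 K), v ∉ T → Algebra.IsUnramifiedIn (𝓞 L) v.asIdeal) :
    (∃ 𝔪 : Ideal (𝓞 K), 𝔪 ≠ ⊥ ∧ (∀ v : HeightOneSpectrum (𝓞 K), 𝔪 ≤ v.asIdeal → v ∈ T) ∧
      IsRayClassCharacter 𝔪 (fun v => if v ∈ T then (0 : ℂ) else
        (charHecke L χ artinReciprocity_character_holds).valueAtUniformizer v)) ∧
    (∀ v : HeightOneSpectrum (𝓞 K), v ∉ T →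
      (fun v => if v ∈ T then (0 : ℂ) else
        (charHecke L χ artinReciprocity_character_holds).valueAtUniformizer v) v ^ 3 = 1) ∧
    (∀ v ∈ T, (fun v => if v ∈ T then (0 : ℂ) else
        (charHecke L χ artinReciprocity_character_holds).valueAtUniformizer v) v = 0) := by
  set hR := artinReciprocity_character_holds
  set ω := charHecke L χ hR with hω
  have hfin : ω.IsFiniteOrder := charHecke_isFiniteOrder L χ hR
  refine ⟨?_, fun v hv => ?_, fun v hv => by simp [hv]⟩
  · -- a module of definition, moved onto `T`
    obtain ⟨T₀, hT₀, e, hmod⟩ := HeckeCharacter.exists_moduleOfDefinition_of_isFiniteOrder hfin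
    have hmod' : HeckeCharacter.IsModulus ω hT₀.toFinset e := fun x h1 h2 h3 =>
      hmod x h1 h2 fun v hv => h3 v (hT₀.mem_toFinset.mpr hv)
    have hmodT : HeckeCharacter.IsModulus ω T e :=
      hmod'.of_isUnramifiedAt fun v _ hvT => charHecke_isUnramifiedAt L χ hR (hunr v hvT)
    have hray := HeckeCharacter.isRayClassCharacter_of_isModulus hfin hmodT
    refine ⟨HeckeCharacter.modulusIdeal T e, HeckeCharacter.modulusIdeal_ne_bot T e,
      fun v hv => HeckeCharacter.modulusIdeal_le_iff.mp hv, ?_⟩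
    exact isRayClassCharacter_piecewise (HeckeCharacter.modulusIdeal_ne_bot T e) hray T
      fun v hv => HeckeCharacter.modulusIdeal_le_iff.mpr hv
  · simp only [if_neg hv]
    rw [hω, charHecke_valueAtUniformizer L χ hR (hunr v hv), ← Units.val_pow_eq_pow_val, ← map_pow,
      ← h3, pow_card_eq_one', map_one, Units.val_one]

open scoped Classical in
/-- Off `T`, `ψ(𝔭) = χ(Frob_𝔭)`. [cite: CasselsFrohlichANT1967, Ch. VII §4.2 Corollary (iii)] -/
theorem cubicRayClassFunction_apply_of_not_mem (χ : (L ≃ₐ[K] L) →* ℂˣ)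
    (T : Finset (HeightOneSpectrum (𝓞 K)))
    (hunr : ∀ v : HeightOneSpectrum (𝓞 K), v ∉ T → Algebra.IsUnramifiedIn (𝓞 L) v.asIdeal)
    {v : HeightOneSpectrum (𝓞 K)} (hv : v ∉ T) :
    (fun v => if v ∈ T then (0 : ℂ) else
        (charHecke L χ artinReciprocity_character_holds).valueAtUniformizer v) v =
      ((χ (galFrob K L v) : ℂˣ) : ℂ) := by
  simp only [if_neg hv]
  exact charHecke_valueAtUniformizer L χ artinReciprocity_character_holds (hunr v hv)

end Generic

/-! ### `ψ` determines `L` (Bauer) -/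

section Separation

variable {K : Type} [Field K] [NumberField K]

open scoped Classical in
/-- **The prime-value function determines the field.**  For two abelian `L₁, L₂ ⊆ K̄` with INJECTIVE
characters `χᵢ` of `Gal(Lᵢ/K)`, both unramified outside `T`, equality of the functions
`ψᵢ = (𝔭 ↦ ω_{χᵢ}(ϖ_𝔭) off T, 0 on T)` forces `L₁ = L₂`: off `T`, `χ₁(Frob_𝔭(L₁)) = χ₂(Frob_𝔭(L₂))`, so
`Frob_𝔭(L₁) = 1 ↔ Frob_𝔭(L₂) = 1`, i.e. `𝔭` splits completely in `L₁` iff in `L₂`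
(`mem_splitPrimes_iff_galFrob_eq_one`); Bauer's theorem (`eq_of_splitPrimes_eventuallyEq`, in the
compositum `L₁L₂`) gives `L₁ = L₂`. [cite: NeukirchANT1999, Ch. VII Cor. (13.10)] -/
theorem eq_of_cubicRayClassFunction_eq
    (L₁ L₂ : IntermediateField K (AlgebraicClosure K)) [FiniteDimensional K L₁] [IsAbelianGalois K L₁]
    [NumberField L₁] [FiniteDimensional K L₂] [IsAbelianGalois K L₂] [NumberField L₂]
    (χ₁ : (L₁ ≃ₐ[K] L₁) →* ℂˣ) (χ₂ : (L₂ ≃ₐ[K] L₂) →* ℂˣ) (hχ₁ : Function.Injective χ₁)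
    (hχ₂ : Function.Injective χ₂) (T : Finset (HeightOneSpectrum (𝓞 K)))
    (hunr₁ : ∀ v : HeightOneSpectrum (𝓞 K), v ∉ T → Algebra.IsUnramifiedIn (𝓞 L₁) v.asIdeal)
    (hunr₂ : ∀ v : HeightOneSpectrum (𝓞 K), v ∉ T → Algebra.IsUnramifiedIn (𝓞 L₂) v.asIdeal)
    (h : (fun v => if v ∈ T then (0 : ℂ) else
        (charHecke L₁ χ₁ artinReciprocity_character_holds).valueAtUniformizer v) =
      (fun v => if v ∈ T then (0 : ℂ) else
        (charHecke L₂ χ₂ artinReciprocity_character_holds).valueAtUniformizer v)) :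
    L₁ = L₂ := by
  set hR := artinReciprocity_character_holds
  -- Frobenius triviality agrees off `T`
  have hiff : ∀ v : HeightOneSpectrum (𝓞 K), v ∉ T → (galFrob K L₁ v = 1 ↔ galFrob K L₂ v = 1) := by
    intro v hv
    have h1 := congrFun h v
    simp only [if_neg hv] at h1
    rw [charHecke_valueAtUniformizer L₁ χ₁ hR (hunr₁ v hv),
      charHecke_valueAtUniformizer L₂ χ₂ hR (hunr₂ v hv)] at h1
    have h1' : χ₁ (galFrob K L₁ v) = χ₂ (galFrob K L₂ v) := Units.val_injective h1
    constructor
    · intro hg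
      apply hχ₂
      rw [map_one, ← h1', hg, map_one]
    · intro hg
      apply hχ₁
      rw [map_one, h1', hg, map_one]
  -- the completely split primes agree off `T`
  have hsplit : ∀ᶠ v : HeightOneSpectrum (𝓞 K) in Filter.cofinite,
      v ∈ splitPrimes K L₁ ↔ v ∈ splitPrimes K L₂ := by
    rw [Filter.eventually_cofinite]
    refine T.finite_toSet.subset fun v hv => ?_
    by_contra hvT
    exact hv (by
      rw [mem_splitPrimes_iff_galFrob_eq_one (hunr₁ v hvT), mem_splitPrimes_iff_galFrob_eq_one (hunr₂ v hvT)]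
      exact hiff v hvT)
  -- Bauer in the compositum
  set Ω := AlgebraicClosure K
  set L₀ : IntermediateField K Ω := L₁ ⊔ L₂ with hL₀def
  haveI : FiniteDimensional K L₀ := IntermediateField.finiteDimensional_sup L₁ L₂
  haveI : Normal K L₀ := inferInstance
  haveI : IsGalois K L₀ := IsGalois.mk
  haveI : NumberField L₀ := NumberField.of_module_finite K L₀
  set F₁ : IntermediateField K L₀ := IntermediateField.restrict (le_sup_left : L₁ ≤ L₀) with hF₁
  set F₂ : IntermediateField K L₀ := IntermediateField.restrict (le_sup_right : L₂ ≤ L₀) with hF₂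
  haveI : IsGalois K F₁ := IsGalois.of_algEquiv (IntermediateField.restrict_algEquiv _)
  haveI : IsGalois K F₂ := IsGalois.of_algEquiv (IntermediateField.restrict_algEquiv _)
  haveI : NumberField F₁ := NumberField.of_module_finite K F₁
  haveI : NumberField F₂ := NumberField.of_module_finite K F₂
  have hF : F₁ = F₂ := by
    refine eq_of_splitPrimes_eventuallyEq F₁ F₂ (hsplit.mono fun v hv => ?_)
    rw [← splitPrimes_eq_of_algEquiv (IntermediateField.restrict_algEquiv (le_sup_left : L₁ ≤ L₀)),
      ← splitPrimes_eq_of_algEquiv (IntermediateField.restrict_algEquiv (le_sup_right : L₂ ≤ L₀))]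
    exact hv
  have h1 : IntermediateField.lift F₁ = L₁ := IntermediateField.lift_restrict _
  have h2 : IntermediateField.lift F₂ = L₂ := IntermediateField.lift_restrict _
  rw [← h1, ← h2, hF]

end Separation

/-! ### Quadratic base: the dihedral closure and the rational integers -/

section Quadratic

variable {k : Type} [Field k] [NumberField k] [IsGalois ℚ k]
  (L : IntermediateField k (AlgebraicClosure k)) [FiniteDimensional k L] [IsGalois ℚ L]
  [IsAbelianGalois k L] [NumberField L]

/-- **Frobenius at conjugate primes are inverse** in the `S₃`-closure: `Frob_{σ𝔭} = τ Frob_𝔭 τ⁻¹ = Frob_𝔭⁻¹`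
for `τ ∈ Gal(L/ℚ)` non-trivial on `k`, `σ = τ|_k` (`galFrob_galois_smul`, `conjRestrict_eq_inv`).
[cite: DavenportHeilbronn1971, §6 (Gal(K₆/ℚ) = S₃)] -/
theorem galFrob_smul_eq_inv (hk : finrank ℚ k = 2) (h3 : finrank k L = 3)
    {Kc : Type*} [Field Kc] [Algebra ℚ Kc] (hKG : ¬ IsGalois ℚ Kc) (ι : Kc →ₐ[ℚ] L)
    {τ : L ≃ₐ[ℚ] L} (hτ : τ.restrictNormal k ≠ 1) {v : HeightOneSpectrum (𝓞 k)}
    (hunr : Algebra.IsUnramifiedIn (𝓞 L) (τ.restrictNormal k • v).asIdeal) :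
    galFrob k L (τ.restrictNormal k • v) = (galFrob k L v)⁻¹ := by
  rw [galFrob_galois_smul τ hunr, conjRestrict_eq_inv L hk h3 hKG ι hτ]

omit [NumberField k] [IsGalois ℚ k] [IsGalois ℚ L] [NumberField L] in
/-- In `Gal(L/k)` of order `3`, an element equal to its inverse is trivial. [folklore] -/
theorem eq_one_of_eq_inv (h3 : finrank k L = 3) {g : L ≃ₐ[k] L} (hg : g = g⁻¹) : g = 1 := by
  have hc3 : Nat.card (L ≃ₐ[k] L) = 3 := by rw [IsGalois.card_aut_eq_finrank, h3]
  have hcube : g ^ 3 = 1 := by rw [← hc3]; exact pow_card_eq_one'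
  have hsq : g * g = 1 := by
    nth_rewrite 2 [hg]
    exact mul_inv_cancel g
  rwa [pow_succ, pow_two, hsq, one_mul] at hcube

/-- **Decomposition of an unramified rational prime in a quadratic field**: if `ℓ` is unramified in the
quadratic field `k` (non-trivial automorphism `σ`) and `𝔭 ∣ ℓ`, then either `σ𝔭 = 𝔭` and `(ℓ) = 𝔭`
(inert), or `σ𝔭 ≠ 𝔭` and `(ℓ) = 𝔭 · σ𝔭` (split): the primes above `ℓ` are the conjugates of `𝔭`,
`efg = 2` and `e = 1`. [cite: Marcus2018, Ch. 3, Thm. 25] -/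
theorem span_natCast_eq_of_isUnramifiedIn (hk : finrank ℚ k = 2) (σ : k ≃ₐ[ℚ] k) (hσ : σ ≠ 1)
    {ℓ : ℕ} (hℓ : ℓ.Prime) (hunr : Algebra.IsUnramifiedIn (𝓞 k) (Ideal.span {(ℓ : ℤ)}))
    (v : HeightOneSpectrum (𝓞 k)) (hv : ((ℓ : ℤ) : 𝓞 k) ∈ v.asIdeal) :
    (σ • v = v ∧ Ideal.span {((ℓ : ℤ) : 𝓞 k)} = v.asIdeal) ∨
      (σ • v ≠ v ∧ Ideal.span {((ℓ : ℤ) : 𝓞 k)} = v.asIdeal * (σ • v).asIdeal) := by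
  classical
  haveI : IsGaloisGroup (k ≃ₐ[ℚ] k) ℤ (𝓞 k) := IsGaloisGroup.of_isFractionRing (k ≃ₐ[ℚ] k) ℤ (𝓞 k) ℚ k
  have hG : Nat.card (k ≃ₐ[ℚ] k) = 2 := by rw [IsGalois.card_aut_eq_finrank, hk]
  -- the prime `p = (ℓ)` of `ℤ` below `𝔭`
  set P : Ideal (𝓞 k) := v.asIdeal with hPdef
  haveI := v.isMaximal
  set p : Ideal ℤ := Ideal.span {(ℓ : ℤ)} with hpdef
  have hpprime : p.IsPrime := (Ideal.span_singleton_prime (by exact_mod_cast hℓ.ne_zero)).mpr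
    (Nat.prime_iff_prime_int.mp hℓ)
  have hp0 : p ≠ ⊥ := by
    rw [hpdef, Ne, Ideal.span_singleton_eq_bot]; exact_mod_cast hℓ.ne_zero
  haveI hpmax : p.IsMaximal := hpprime.isMaximal hp0
  have hunder : P.under ℤ = p := by
    refine (hpmax.eq_of_le (Ideal.IsPrime.under ℤ P).ne_top fun x hx => ?_).symm
    rw [hpdef, Ideal.mem_span_singleton] at hx
    obtain ⟨c, rfl⟩ := hx
    rw [Ideal.mem_comap, map_mul, eq_intCast, eq_intCast]
    exact Ideal.mul_mem_right _ _ hv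
  have hPover : P ∈ p.primesOver (𝓞 k) := ⟨v.isPrime, ⟨hunder.symm⟩⟩
  -- `p 𝓞_k = ∏_{𝔮 ∣ p} 𝔮` (all `e = 1`)
  have hfac := Ideal.map_algebraMap_eq_finsetProd_pow (R := 𝓞 k) hp0
  have hmap : p.map (algebraMap ℤ (𝓞 k)) = Ideal.span {((ℓ : ℤ) : 𝓞 k)} := by
    rw [hpdef, Ideal.map_span, Set.image_singleton, eq_intCast]
  have he1 : ∀ Q ∈ p.primesOver (𝓞 k), Q.ramificationIdx ℤ = 1 := by
    intro Q hQ
    haveI := hQ.1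
    exact hunr.ramificationIdx_eq_one hQ.2
  -- every prime above `p` is `P` or `σ • P`
  have hconj : ∀ Q ∈ p.primesOver (𝓞 k), Q = P ∨ Q = σ • P := by
    intro Q hQ
    haveI := hQ.1
    haveI := hQ.2
    haveI := hPover.2
    obtain ⟨ρ, rfl⟩ := Ideal.exists_smul_eq_of_isGaloisGroup p P Q (k ≃ₐ[ℚ] k)
    rcases eq_one_or_eq_of_card_eq_two hG hσ ρ with h | h
    · exact Or.inl (by rw [h, one_smul])
    · exact Or.inr (by rw [h])
  have hσP : σ • P ∈ p.primesOver (𝓞 k) := by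
    have hprime : (σ • P).IsPrime := by
      haveI := v.isPrime
      exact Ideal.IsPrime.smul σ
    refine ⟨hprime, ⟨?_⟩⟩
    rw [Ideal.under_smul, hunder]
  by_cases hfix : σ • P = P
  · left
    refine ⟨HeightOneSpectrum.ext (by rw [HeightOneSpectrum.smul_asIdeal]; exact hfix), ?_⟩
    have hset : p.primesOver (𝓞 k) = {P} := by
      ext Q
      simp only [Set.mem_singleton_iff]
      constructor
      · intro hQ
        rcases hconj Q hQ with h | h
        · exact h
        · rw [h, hfix]
      · rintro rfl
        exact hPover
    rw [← hmap, hfac]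
    simp only [hset, Set.toFinset_singleton, Finset.prod_singleton]
    rw [he1 P hPover, pow_one]
  · right
    have hne : P ≠ σ • P := fun h => hfix h.symm
    refine ⟨fun h => hfix (by rw [← HeightOneSpectrum.smul_asIdeal, h]), ?_⟩
    have hefg :=
      Ideal.ncard_primesOver_mul_ramificationIdxIn_mul_inertiaDegIn p (𝓞 k) (k ≃ₐ[ℚ] k)
    rw [hG] at hefg
    have hset : p.primesOver (𝓞 k) = {P, σ • P} := by
      symm
      refine Set.eq_of_subset_of_ncard_le ?_ ?_ (IsDedekindDomain.primesOver_finite p (𝓞 k))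
      · intro Q hQ
        rcases hQ with rfl | rfl
        · exact hPover
        · exact hσP
      · rw [Set.ncard_pair hne]
        have h1 : 1 ≤ p.ramificationIdxIn (𝓞 k) * p.inertiaDegIn (𝓞 k) :=
          Nat.one_le_iff_ne_zero.mpr (mul_ne_zero (Ideal.ramificationIdxIn_ne_zero (k ≃ₐ[ℚ] k))
            (Ideal.inertiaDegIn_ne_zero (k ≃ₐ[ℚ] k)))
        nlinarith [hefg, h1]
    rw [← hmap, hfac]
    simp only [hset, Set.toFinset_insert, Set.toFinset_singleton]
    rw [Finset.prod_insert (by simpa using hne), Finset.prod_singleton, he1 P hPover, he1 (σ • P) hσP,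
      pow_one, pow_one, HeightOneSpectrum.smul_asIdeal]

open scoped Classical in
/-- **`ψ` kills the rational primes prime to `T`** (the character of the `S₃`-closure is a ring class
character).  Let `k` be quadratic, `L ⊆ k̄` its abelian cubic extension receiving a non-Galois cubic
field (`CubicResolventClosure.exists_resolventClosure`), `T` a finite set of primes of `k` outside which
`L/k` is unramified and which contains every prime dividing `d_k`.  Then for a rational prime `ℓ` lying
in no prime of `T`, `ψ((ℓ)) = 1`: with `𝔭 ∣ ℓ`, `Frob_{σ𝔭} = Frob_𝔭⁻¹` (`galFrob_smul_eq_inv`); if `ℓ`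
is inert then `σ𝔭 = 𝔭` forces `Frob_𝔭 = 1`, and if `ℓ = 𝔭 · σ𝔭` splits then
`ψ((ℓ)) = χ(Frob_𝔭)χ(Frob_𝔭)⁻¹ = 1`. [cite: DavenportHeilbronn1971, §6] -/
theorem idealPow_span_natCast_eq_one (hk : finrank ℚ k = 2) (h3 : finrank k L = 3)
    {Kc : Type*} [Field Kc] [Algebra ℚ Kc] (hKG : ¬ IsGalois ℚ Kc) (ι : Kc →ₐ[ℚ] L)
    (χ : (L ≃ₐ[k] L) →* ℂˣ) (T : Finset (HeightOneSpectrum (𝓞 k)))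
    (hunr : ∀ v : HeightOneSpectrum (𝓞 k), v ∉ T → Algebra.IsUnramifiedIn (𝓞 L) v.asIdeal)
    (hTdisc : ∀ v : HeightOneSpectrum (𝓞 k), ((discr k : ℤ) : 𝓞 k) ∈ v.asIdeal → v ∈ T)
    {ℓ : ℕ} (hℓ : ℓ.Prime) (hℓT : ∀ v ∈ T, ((ℓ : ℤ) : 𝓞 k) ∉ v.asIdeal) :
    idealPow k (fun v => if v ∈ T then (0 : ℂ) else
        (charHecke L χ artinReciprocity_character_holds).valueAtUniformizer v)
      (Ideal.span {((ℓ : ℤ) : 𝓞 k)}) = 1 := by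
  set hR := artinReciprocity_character_holds
  set ψ := fun v : HeightOneSpectrum (𝓞 k) => if v ∈ T then (0 : ℂ) else
    (charHecke L χ hR).valueAtUniformizer v with hψdef
  have hψ : ∀ v, v ∉ T → ψ v = ((χ (galFrob k L v) : ℂˣ) : ℂ) := fun v hv =>
    cubicRayClassFunction_apply_of_not_mem L χ T hunr hv
  -- a prime `𝔭 ∣ ℓ` of `k`, not in `T`
  haveI hpmax : (Ideal.span {(ℓ : ℤ)}).IsMaximal :=
    ((Ideal.span_singleton_prime (by exact_mod_cast hℓ.ne_zero)).mpr (Nat.prime_iff_prime_int.mp hℓ)).isMaximal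
      (by rw [Ne, Ideal.span_singleton_eq_bot]; exact_mod_cast hℓ.ne_zero)
  obtain ⟨Q, hQmax, hQover⟩ :=
    Ideal.exists_maximal_ideal_liesOver_of_isIntegral (S := 𝓞 k) (Ideal.span {(ℓ : ℤ)})
  have hQ0 : Q ≠ ⊥ := Ideal.IsMaximal.ne_bot_of_isIntegral_int Q
  set v : HeightOneSpectrum (𝓞 k) := ⟨Q, hQmax.isPrime, hQ0⟩ with hvdef
  have hℓv : ((ℓ : ℤ) : 𝓞 k) ∈ v.asIdeal := by
    have : (ℓ : ℤ) ∈ Q.under ℤ := by rw [← hQover.over]; exact Ideal.mem_span_singleton_self _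
    rw [Ideal.mem_comap, eq_intCast] at this
    exact this
  -- the non-trivial automorphism of `k`, lifted to `L`
  obtain ⟨τ, hτ⟩ := exists_restrictNormal_ne_one L hk
  set σ := τ.restrictNormal k with hσdef
  have hσv : ((ℓ : ℤ) : 𝓞 k) ∈ (σ • v).asIdeal := by
    rw [HeightOneSpectrum.smul_asIdeal, Ideal.mem_pointwise_smul_iff_inv_smul_mem]
    have : σ⁻¹ • ((ℓ : ℤ) : 𝓞 k) = ((ℓ : ℤ) : 𝓞 k) := by
      apply RingOfIntegers.ext
      change σ⁻¹ • (((ℓ : ℤ) : 𝓞 k) : k) = (((ℓ : ℤ) : 𝓞 k) : k)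
      rw [AlgEquiv.smul_def, show (((ℓ : ℤ) : 𝓞 k) : k) = ((ℓ : ℤ) : k) from map_intCast _ _, map_intCast]
    rw [this]
    exact hℓv
  have hvT : v ∉ T := fun h => hℓT v h hℓv
  have hσvT : σ • v ∉ T := fun h => hℓT _ h hσv
  -- `ℓ` is unramified in `k`
  have hunrk : Algebra.IsUnramifiedIn (𝓞 k) (Ideal.span {(ℓ : ℤ)}) := by
    refine (NumberField.not_dvd_discr_iff_isUnramifiedIn k (𝓞 k) (Nat.prime_iff_prime_int.mp hℓ)).mp ?_
    rintro ⟨c, hc⟩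
    refine hvT (hTdisc v ?_)
    rw [hc, Int.cast_mul]
    exact Ideal.mul_mem_right _ _ hℓv
  -- Frobenius relations
  have hinv : galFrob k L (σ • v) = (galFrob k L v)⁻¹ :=
    galFrob_smul_eq_inv L hk h3 hKG ι hτ (hunr _ hσvT)
  rcases span_natCast_eq_of_isUnramifiedIn hk σ hτ hℓ hunrk v hℓv with ⟨hfix, hspan⟩ | ⟨hne, hspan⟩
  · -- inert: `Frob_𝔭 = Frob_𝔭⁻¹`, so `Frob_𝔭 = 1`
    rw [hfix] at hinv
    rw [hspan, idealPow_asIdeal, hψ v hvT, eq_one_of_eq_inv L h3 hinv, map_one, Units.val_one]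
  · -- split: `ψ(𝔭) ψ(σ𝔭) = χ(Frob_𝔭) χ(Frob_𝔭)⁻¹ = 1`
    rw [hspan, idealPow_mul ψ v.ne_bot (σ • v).ne_bot, idealPow_asIdeal, idealPow_asIdeal, hψ v hvT,
      hψ _ hσvT, hinv, map_inv, Units.val_inv_eq_inv_val, mul_inv_cancel₀]
    exact Units.ne_zero _

open scoped Classical in
/-- **`ψ((a)) = 1` for every nonzero rational integer `a` prime to `T`** (multiplicativity over the
prime factorisation of `a`; `idealPow_span_natCast_eq_one`). [cite: DavenportHeilbronn1971, §6] -/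
theorem idealPow_span_intCast_eq_one (hk : finrank ℚ k = 2) (h3 : finrank k L = 3)
    {Kc : Type*} [Field Kc] [Algebra ℚ Kc] (hKG : ¬ IsGalois ℚ Kc) (ι : Kc →ₐ[ℚ] L)
    (χ : (L ≃ₐ[k] L) →* ℂˣ) (T : Finset (HeightOneSpectrum (𝓞 k)))
    (hunr : ∀ v : HeightOneSpectrum (𝓞 k), v ∉ T → Algebra.IsUnramifiedIn (𝓞 L) v.asIdeal)
    (hTdisc : ∀ v : HeightOneSpectrum (𝓞 k), ((discr k : ℤ) : 𝓞 k) ∈ v.asIdeal → v ∈ T)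
    {a : ℤ} (ha : a ≠ 0) (haT : ∀ v ∈ T, ((a : ℤ) : 𝓞 k) ∉ v.asIdeal) :
    idealPow k (fun v => if v ∈ T then (0 : ℂ) else
        (charHecke L χ artinReciprocity_character_holds).valueAtUniformizer v)
      (Ideal.span {((a : ℤ) : 𝓞 k)}) = 1 := by
  set ψ := fun v : HeightOneSpectrum (𝓞 k) => if v ∈ T then (0 : ℂ) else
    (charHecke L χ artinReciprocity_character_holds).valueAtUniformizer v with hψdef
  induction a using UniqueFactorizationMonoid.induction_on_prime with
  | h₁ => exact absurd rfl ha
  | h₂ u hu =>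
    have : Ideal.span {((u : ℤ) : 𝓞 k)} = ⊤ := by
      rw [Ideal.span_singleton_eq_top]
      exact (hu.map (Int.castRingHom (𝓞 k)))
    rw [this, idealPow_top]
  | h₃ b p hb hp ih =>
    have hpT : ∀ v ∈ T, ((p : ℤ) : 𝓞 k) ∉ v.asIdeal := fun v hv h =>
      haT v hv (by rw [Int.cast_mul]; exact Ideal.mul_mem_right _ _ h)
    have hbT : ∀ v ∈ T, ((b : ℤ) : 𝓞 k) ∉ v.asIdeal := fun v hv h =>
      haT v hv (by rw [Int.cast_mul]; exact Ideal.mul_mem_left _ _ h)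
    have hp0 : ((p : ℤ) : 𝓞 k) ≠ 0 := by exact_mod_cast hp.ne_zero
    have hb0 : ((b : ℤ) : 𝓞 k) ≠ 0 := by exact_mod_cast hb
    rw [Int.cast_mul, ← Ideal.span_singleton_mul_span_singleton,
      idealPow_mul ψ (by rw [Ne, Ideal.span_singleton_eq_bot]; exact hp0)
        (by rw [Ne, Ideal.span_singleton_eq_bot]; exact hb0), ih hb hbT, mul_one]
    -- `p = ± ℓ` for the rational prime `ℓ = |p|`
    have hℓ : p.natAbs.Prime := Int.prime_iff_natAbs_prime.mp hp
    have hspan : Ideal.span {((p : ℤ) : 𝓞 k)} = Ideal.span {((p.natAbs : ℤ) : 𝓞 k)} := by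
      rcases Int.natAbs_eq p with h | h
      · rw [← h]
      · conv_lhs => rw [h]
        rw [Int.cast_neg, Ideal.span_singleton_neg]
    have hℓT : ∀ v ∈ T, ((p.natAbs : ℤ) : 𝓞 k) ∉ v.asIdeal := fun v hv h => by
      refine hpT v hv ?_
      rw [← Ideal.span_singleton_le_iff_mem, hspan, Ideal.span_singleton_le_iff_mem]
      exact h
    rw [hspan]
    exact idealPow_span_natCast_eq_one L hk h3 hKG ι χ T hunr hTdisc hℓ hℓT

end Quadratic

end Literature.NumberTheory.CubicFields

end
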